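import Literature.NumberTheory.EllipticCurves.H1UnramifiedFiniteProofs
import Literature.NumberTheory.EllipticCurves.KummerUnramifiedConverse
import Literature.NumberTheory.NumberFields.UnramifiedHomsOddNarrowClassNumber
import Literature.NumberTheory.GaloisRepresentations.AbsGaloisGroup
import HarnessLib

/-!
# Quadratic characters of a number field with ODD class number in which totally positive units are squares:
# the Kummer parity counts `#Hom(Gal(K̄/K'), ℤ/2; S', signs) ≤ 2^{#S'}` (proved; no definition, no named fact)

`Proofs`-style file in topic `NumberTheory/NumberFields` (namespace
`Literature.NumberTheory.NumberFields.QuadraticCharactersOddClassNumberCount`), written by the prover seat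
`bsd-2adic-t42` GEN 27 (cell `bsd-2adic`; road «H514-KERNEL» = Greenberg LNM 1716 Prop. 5.14 at `p = 2` as a kernel
theorem; `--supports` stmt-BirchSwinnertonDyer-19923; closes nothing).  It supplies the two UNIFORM character counts
of that road at a finite layer `K' = ℚ_n` of the cyclotomic `ℤ₂`-tower (where Weber gives `h(ℚ_n)` odd and «every
totally positive unit is a square», tree `odd_classNumber_and_forall_isSquare_layer_two`), for a general number field
`K`, a finite subextension `K' ⊆ K̄` with `U' = Gal(K̄/K') ≤ Γ_K`, and `M ↪ ℤ/2ℤ`: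

* §1 `exists_unit_mul_sq_of_even_valuation` (h odd, all valuations even ⟹ `a = u c²`) and
  `exists_eq_sq_of_even_valuation_of_totallyPositive` (+ totally positive, `U⁺ = U²` ⟹ `a` is a square);
* §2 `exists_kummerGenerator_two` (Kummer datum `(a_f, α_f)` of `f ∈ Hom(U', M; S)`, `α² = a`,
  `τ α = (−1)^{f τ} α`, `ord_w(a_f)` even off the places above `S` — the tree's `exists_kummer_generator` /
  `dvd_log_valuation_of_inertia_fixes_root` with the transport of `unramifiedHoms_fixingSubgroup_finite`) and
  `embedding_pos_of_kills_complexConjugation` (if `f` kills the complex conjugations of `Γ_K` lying in `U'`, then `a_f`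
  is totally positive);
* §4 **`finite_and_natCard_le_of_kills_complexConjugation`**: the continuous homomorphisms `U' → M` unramified
  outside `S` that kill every complex conjugation form a finite set of size `≤ 2^{#S'}` (`S'` = places of `K'`
  above `S`) — Greenberg's «`K_∞` can't contain any totally real subfield larger than `ℚ_∞`» counted;
* §5 **`finite_and_natCard_le_unramifiedHoms_of_odd`**: for `U'` NORMAL with totally real fixed field and `S`
  consisting of ODD places, the continuous homomorphisms `U' → M` unramified at EVERY finite place outside `S` form a
  finite set of size `≤ 2^{#S'}` — two characters with equal parities differ by one whose Kummer class is a unit,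
  hence unramified everywhere, hence zero by the narrow class-field-theoretic vanishing
  `UnramifiedHomsOddNarrowClassNumber.eq_zero_of_kills_inertia_of_odd_classNumber_of_forall_isSquare`
  (Greenberg's «`L*_∞ = ℚ_∞`»).

Both counts inject the set of characters into `(ℤ/2)^{S'}` by the parity vector `(ord_w(a_f) mod 2)_{w ∈ S'}`.

HONEST FRAMING: theorems only (plus private helpers); nothing about any curve; BSD is not proved by any of this.

References: [GreenbergLNM1716] §5, proof of Lemma 5.9 at `p = 2` (p. 113: `M_∞ = ℚ_∞`, `K_∞`) and of Prop. 5.14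
(p. 122: `L*_∞ = ℚ_∞`); [Washington1997] Thm. 10.4 / Cor. 10.5 (Weber), §10.2 (Kummer theory), §13.3;
[SilvermanAEC2009] Prop. VIII.1.6 (proof); [Lang1983] Ch. 6 Prop. 1.3.
-/

set_option autoImplicit false

noncomputable section

open scoped Classical NumberField
open NumberField IsDedekindDomain Field IntermediateField

namespace Literature.NumberTheory.NumberFields.QuadraticCharactersOddClassNumberCount

open Literature.NumberTheory.EllipticCurves Literature.NumberTheory.GaloisRepresentations
  Literature.NumberTheory.NumberFields

/-! ## §1 The key lemma: a totally positive element with even valuations everywhere is a square -/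

/-- In a finite group of odd order, `c ^ 2 = 1` forces `c = 1`. [folklore] -/
private theorem eq_one_of_sq_eq_one_of_odd_card {G : Type*} [Group G] [Finite G] (hodd : Odd (Nat.card G))
    {c : G} (hc : c ^ 2 = 1) : c = 1 := by
  have h1 : orderOf c ∣ 2 := orderOf_dvd_of_pow_eq_one hc
  have h2 : orderOf c ∣ Nat.card G := orderOf_dvd_natCard c
  have hodd' : Odd (orderOf c) := Odd.of_dvd_nat hodd h2
  have h3 : orderOf c = 1 := by
    rcases (Nat.dvd_prime Nat.prime_two).mp h1 with h | h
    · exact h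
    · exact absurd (h ▸ hodd') (by decide)
  exact orderOf_eq_one_iff.mp h3

/-- **Even valuations and odd class number ⟹ unit times square.** Let `L` be a number field with ODD class number. If
`a ∈ L^×` has `ord_v(a)` even at every finite place `v`, then `a = u · c²` for a unit `u` of `𝓞 L` and `c ∈ L^×`:
`(a) = 𝔞²` up to squares of elements and `𝔞` is principal because `Cl(L)` has no `2`-torsion.
[cite: Washington1997, §13.3 (proof of Prop. 13.22)] [cite: SilvermanAEC2009, proof of Prop. VIII.1.6] -/
theorem exists_unit_mul_sq_of_even_valuation (L : Type*) [Field L] [NumberField L]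
    (hodd : Odd (classNumber L)) {a : L} (ha : a ≠ 0)
    (hval : ∀ v : HeightOneSpectrum (𝓞 L), (2 : ℤ) ∣ WithZero.log (v.valuation L a)) :
    ∃ (u : (𝓞 L)ˣ) (c : L), c ≠ 0 ∧ a = ((u : 𝓞 L) : L) * c ^ 2 := by
  -- an integral representative `r` of the class of `a` modulo squares: `a = r z²`
  obtain ⟨r, x, hr, hx, hxa⟩ := IsDedekindDomain.exists_mk_eq_of_pos (R := 𝓞 L) (K := L) two_pos
    (QuotientGroup.mk (Units.mk0 a ha) : Lˣ ⧸ (powMonoidHom 2 : Lˣ →* Lˣ).range)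
  obtain ⟨z, hz⟩ : ∃ z : Lˣ, Units.mk0 a ha = x * z ^ 2 := by
    have h := (QuotientGroup.eq (s := (powMonoidHom 2 : Lˣ →* Lˣ).range)).mp hxa
    obtain ⟨z, hz⟩ := h
    exact ⟨z, by rw [powMonoidHom_apply] at hz; rw [hz, mul_inv_cancel_left]⟩
  have haz : a = algebraMap (𝓞 L) L r * (z : L) ^ 2 := by
    have := congrArg (fun u : Lˣ => (u : L)) hz
    simpa [hx] using this
  -- `ord_v(r)` is even for every `v`
  have hxmem : (QuotientGroup.mk x : Lˣ ⧸ (powMonoidHom 2 : Lˣ →* Lˣ).range) ∈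
      selmerGroup (K := L) (S := (∅ : Set (HeightOneSpectrum (𝓞 L)))) (n := 2) := by
    rw [hxa, IsDedekindDomain.mk_mem_selmerGroup_iff]
    intro v _
    exact hval v
  rw [IsDedekindDomain.mk_mem_selmerGroup_iff] at hxmem
  have hcount : ∀ v : HeightOneSpectrum (𝓞 L),
      2 ∣ (Associates.mk v.asIdeal).count (Associates.mk (Ideal.span {r})).factors := by
    intro v
    have h1 := hxmem v (Set.notMem_empty v)
    rw [← HeightOneSpectrum.toAdd_valuationOfNeZero_eq_log, HeightOneSpectrum.toAdd_valuationOfNeZero_of_eq_algebraMap v hr hx,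
      dvd_neg] at h1
    exact_mod_cast h1
  -- `(r) = J²`, and `J` is principal since `Cl(L)` has odd order
  obtain ⟨J, hJ⟩ := exists_pow_eq_span_singleton_of_dvd_count hr hcount
  have hJ0 : J ≠ 0 := by
    intro h0
    rw [h0, zero_pow two_ne_zero, eq_comm, Ideal.zero_eq_bot, Ideal.span_singleton_eq_bot] at hJ
    exact hr hJ
  have hJmem : J ∈ nonZeroDivisors (Ideal (𝓞 L)) := mem_nonZeroDivisors_of_ne_zero hJ0
  have hrmem : Ideal.span ({r} : Set (𝓞 L)) ∈ nonZeroDivisors (Ideal (𝓞 L)) :=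
    mem_nonZeroDivisors_of_ne_zero (by rw [Ne, Ideal.zero_eq_bot, Ideal.span_singleton_eq_bot]; exact hr)
  have hprinc : (J : Ideal (𝓞 L)).IsPrincipal := by
    have hpow : (⟨J, hJmem⟩ : nonZeroDivisors (Ideal (𝓞 L))) ^ 2 = ⟨Ideal.span {r}, hrmem⟩ :=
      Subtype.ext (by rw [SubmonoidClass.coe_pow, hJ])
    have hsq1 : (ClassGroup.mk0 ⟨J, hJmem⟩) ^ 2 = 1 := by
      rw [← map_pow, hpow, ClassGroup.mk0_eq_one_iff]
      exact ⟨⟨r, rfl⟩⟩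
    have hG : Odd (Nat.card (ClassGroup (𝓞 L))) := by
      rw [Nat.card_eq_fintype_card]; exact hodd
    exact (ClassGroup.mk0_eq_one_iff hJmem).mp (eq_one_of_sq_eq_one_of_odd_card hG hsq1)
  obtain ⟨c, hc⟩ := hprinc
  have hc' : J = Ideal.span {c} := hc
  -- `r = u c²` for a unit `u`
  have hspan : Ideal.span ({r} : Set (𝓞 L)) = Ideal.span {c ^ 2} := by
    rw [← hJ, hc', Ideal.span_singleton_pow]
  obtain ⟨u, hu⟩ := Ideal.span_singleton_eq_span_singleton.mp hspan.symm
  -- `hu : c ^ 2 * u = r`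
  have hc0 : c ≠ 0 := by
    rintro rfl
    rw [Ideal.span_singleton_eq_bot.mpr rfl] at hc'
    exact hJ0 hc'
  have hcL : (algebraMap (𝓞 L) L c) ≠ 0 := by
    rwa [Ne, map_eq_zero_iff _ (FaithfulSMul.algebraMap_injective (𝓞 L) L)]
  refine ⟨u, algebraMap (𝓞 L) L c * (z : L), mul_ne_zero hcL z.ne_zero, ?_⟩
  rw [haz, ← hu, map_mul, map_pow, mul_pow]
  change _ = algebraMap (𝓞 L) L (u : 𝓞 L) * _
  ring

/-- **Key lemma.** Let `L` be a number field with ODD class number in which every totally positive unit is the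
square of a unit (e.g. `L = ℚ(ζ_{2^{n+2}})⁺`, Weber). If `a ∈ L^×` is totally positive and `ord_v(a)` is even at
every finite place `v`, then `a` is a square in `L`: `a = u c²` with a totally positive unit `u = ε²`.
[cite: Washington1997, §13.3 (proof of Prop. 13.22) and Thm. 10.4 / Cor. 10.5] [cite: SilvermanAEC2009, proof of Prop. VIII.1.6] -/
theorem exists_eq_sq_of_even_valuation_of_totallyPositive (L : Type*) [Field L] [NumberField L]
    (hodd : Odd (classNumber L))
    (hsq : ∀ u : (𝓞 L)ˣ, (∀ σ : L →+* ℝ, 0 < σ ((u : 𝓞 L) : L)) → IsSquare u)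
    {a : L} (ha : a ≠ 0) (hpos : ∀ σ : L →+* ℝ, 0 < σ a)
    (hval : ∀ v : HeightOneSpectrum (𝓞 L), (2 : ℤ) ∣ WithZero.log (v.valuation L a)) :
    ∃ γ : L, a = γ ^ 2 := by
  obtain ⟨u, c, hc, hauc⟩ := exists_unit_mul_sq_of_even_valuation L hodd ha hval
  -- `u` is totally positive, hence a square
  have hupos : ∀ σ : L →+* ℝ, 0 < σ ((u : 𝓞 L) : L) := by
    intro σ
    have h1 : σ a = σ ((u : 𝓞 L) : L) * σ c ^ 2 := by rw [hauc, map_mul, map_pow]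
    have hcσ : 0 < σ c ^ 2 := by
      have : σ c ≠ 0 := by rw [Ne, map_eq_zero]; exact hc
      positivity
    have h2 : 0 < σ ((u : 𝓞 L) : L) * σ c ^ 2 := by rw [← h1]; exact hpos σ
    exact pos_of_mul_pos_left h2 hcσ.le
  obtain ⟨ε, hε⟩ := hsq u hupos
  refine ⟨((ε : 𝓞 L) : L) * c, ?_⟩
  rw [hauc, hε]
  push_cast
  ring

/-! ## §2 Kummer generators of quadratic characters of `Gal(K̄/K')` (`d = 2`, `ζ = −1`) -/

section Kummer

variable {K : Type} [Field K] [NumberField K]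

omit [NumberField K] in
/-- The integral closure of `𝓞 K'` in `K̄` contains `\bar ℤ_K` (transport of primes; copy of the tree's
`absIntegers_le_integralClosure`). [folklore] -/
private theorem absIntegers_le_integralClosure' (K' : IntermediateField K (AlgebraicClosure K)) :
    (absIntegers (𝓞 K) K).toSubring ≤ (integralClosure (𝓞 K') (AlgebraicClosure K)).toSubring :=
  absIntegers_le_integralClosure K'

omit [NumberField K] in
/-- The identification `U' = Gal(K̄/K') ≃ (K̄ ≃ₐ[K'] K̄)` for a subgroup `U'` of `Γ_K` GIVEN as the fixing subgroup of
`K'` (`MulEquiv.subgroupCongr` followed by `IntermediateField.fixingSubgroupEquiv`), with its action on `K̄`. [folklore] -/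
private theorem exists_mulEquiv_fixingSubgroup (K' : IntermediateField K (AlgebraicClosure K))
    (U' : Subgroup (absoluteGaloisGroup K)) (hU' : U' = K'.fixingSubgroup) :
    ∃ e : U' ≃* (AlgebraicClosure K ≃ₐ[K'] AlgebraicClosure K),
      ∀ (τ : AlgebraicClosure K ≃ₐ[K'] AlgebraicClosure K) (x : AlgebraicClosure K),
        ((e.symm τ : U') : absoluteGaloisGroup K) • x = τ x := by
  subst hU'
  exact ⟨IntermediateField.fixingSubgroupEquiv K', fun τ x ↦ rfl⟩

/-- **Kummer generator of a quadratic character of `Gal(K̄/K')`, `K' ⊆ K̄` finite over `K`.** For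
`f ∈ Hom(U', M; S)` with `U' = Gal(K̄/K')` (`unramifiedHoms`, `M → ℤ/2ℤ` by `j`) and any identification
`e : U' ≃ Gal(K̄/K')` compatible with the action, there are `a ∈ K'^×` and `α ∈ K̄` with `α² = a`,
`τ α = (−1)^{j f(τ)} α` for every `τ ∈ Gal(K̄/K')`, and `ord_w(a)` EVEN at every finite place `w` of `K'` not above `S`
(`exists_kummer_generator` with `ζ = −1`, `dvd_log_valuation_of_inertia_fixes_root`; the transport of primes and inertia
groups follows the tree's `unramifiedHoms_fixingSubgroup_finite` line by line).
[cite: SilvermanAEC2009, Prop. VIII.1.6 (proof)] [cite: Washington1997, §10.2 (Kummer theory)] -/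
theorem exists_kummerGenerator_two (K' : IntermediateField K (AlgebraicClosure K)) [FiniteDimensional K K']
    (U' : Subgroup (absoluteGaloisGroup K)) (e : U' ≃* (AlgebraicClosure K ≃ₐ[K'] AlgebraicClosure K))
    (he : ∀ (τ : AlgebraicClosure K ≃ₐ[K'] AlgebraicClosure K) (x : AlgebraicClosure K),
        ((e.symm τ : U') : absoluteGaloisGroup K) • x = τ x)
    (hU'open : IsOpen (U' : Set (absoluteGaloisGroup K)))
    (M : Type) [AddCommGroup M] [TopologicalSpace M] [DiscreteTopology M] (j : M →+ ZMod 2)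
    {S : Set (HeightOneSpectrum (𝓞 K))} {f : U' → M} (hf : f ∈ unramifiedHoms U' M S) :
    haveI : NumberField K' := NumberField.of_module_finite K K'
    ∃ a : K', a ≠ 0 ∧ ∃ α : AlgebraicClosure K, α ^ 2 = algebraMap K' (AlgebraicClosure K) a ∧
      (∀ τ : AlgebraicClosure K ≃ₐ[K'] AlgebraicClosure K,
        τ α = (-1) ^ (j (f (e.symm τ))).val * α) ∧
      ∀ w : HeightOneSpectrum (𝓞 K'), HeightOneSpectrum.under (𝓞 K) w ∉ S →
        (2 : ℤ) ∣ WithZero.log (w.valuation K' a) := by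
  classical
  haveI : NumberField K' := NumberField.of_module_finite K K'
  have hζ : IsPrimitiveRoot (-1 : K') 2 := IsPrimitiveRoot.neg_one 0 (by decide)
  -- the transported character
  let T : (AlgebraicClosure K ≃ₐ[K'] AlgebraicClosure K) → ZMod 2 := fun τ ↦ j (f (e.symm τ))
  have hT : ∀ τ, T τ = j (f (e.symm τ)) := fun _ ↦ rfl
  have hadd : ∀ σ τ, T (σ * τ) = T σ + T τ := by
    intro σ τ
    rw [hT, hT, hT, map_mul, hf.2.1, map_add]
  -- `U'` fixes `K'` pointwise
  have hfixK' : ∀ (u : U') (x : AlgebraicClosure K), x ∈ K' → (u : absoluteGaloisGroup K) • x = x := by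
    intro u x hx
    have h := he (e u) x
    rw [MulEquiv.symm_apply_apply] at h
    rw [h]
    exact (e u).commutes ⟨x, hx⟩
  -- continuity ⟹ `T` factors through a finite extension of `K'`
  have hE : ∃ E : IntermediateField K' (AlgebraicClosure K), FiniteDimensional K' E ∧
      ∀ σ ∈ E.fixingSubgroup, T σ = 0 := by
    have h0 : IsOpen (f ⁻¹' {0}) := (isOpen_discrete _).preimage hf.1
    obtain ⟨V, hVopen, hV⟩ := isOpen_induced_iff.mp h0
    have hf1 : f 1 = 0 := by
      have := hf.2.1 1 1
      rw [mul_one] at this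
      exact left_eq_add.mp this
    have h1 : (1 : absoluteGaloisGroup K) ∈ V ∩ (U' : Set (absoluteGaloisGroup K)) := by
      refine ⟨?_, U'.one_mem⟩
      have : (1 : U') ∈ Subtype.val ⁻¹' V := by
        rw [hV]
        exact hf1
      exact this
    have hW : V ∩ (U' : Set (absoluteGaloisGroup K)) ∈ nhds (1 : absoluteGaloisGroup K) :=
      (hVopen.inter hU'open).mem_nhds h1
    obtain ⟨E, hEfin, hEsub⟩ :=
      (krullTopology_mem_nhds_one_iff K (AlgebraicClosure K) _).mp hW
    haveI := hEfin
    let E' : IntermediateField K' (AlgebraicClosure K) :=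
      IntermediateField.extendScalars (F := K') (E := K' ⊔ E) le_sup_left
    haveI : FiniteDimensional K' E' := by
      have hKE : FiniteDimensional K (IntermediateField.restrictScalars K E') := by
        rw [IntermediateField.extendScalars_restrictScalars]
        infer_instance
      haveI : Module.Finite K E' := hKE
      exact Module.Finite.of_restrictScalars_finite K K' E'
    refine ⟨E', inferInstance, fun τ hτ ↦ ?_⟩
    rw [hT]
    have hmemV : ((e.symm τ : U') : absoluteGaloisGroup K) ∈ V := by
      refine (hEsub ?_).1
      rw [SetLike.mem_coe, IntermediateField.mem_fixingSubgroup_iff]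
      intro x hx
      have hx' : x ∈ E' := (le_sup_right : E ≤ K' ⊔ E) hx
      change ((e.symm τ : U') : absoluteGaloisGroup K) • x = x
      rw [he]
      exact (IntermediateField.mem_fixingSubgroup_iff _ _).mp hτ x hx'
    have : e.symm τ ∈ f ⁻¹' {0} := by
      rw [← hV]
      exact hmemV
    rw [this, map_zero]
  obtain ⟨a, ha, α, hα, hσα⟩ := exists_kummer_generator (k := K') (Ω := AlgebraicClosure K) two_pos hζ T hadd hE
  refine ⟨a, ha, α, hα, fun τ ↦ ?_, fun w hw ↦ ?_⟩
  · rw [hσα τ, hT, map_neg, map_one]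
  · -- even valuation at `w ∉ S'`: a prime of the integral closure above `w`, transport of inertia
    haveI := w.isMaximal
    obtain ⟨𝔓', h𝔓'max, h𝔓'comap⟩ :=
      Ideal.exists_ideal_over_maximal_of_isIntegral (S := integralClosure (𝓞 K') (AlgebraicClosure K)) w.asIdeal
        (fun x hx ↦ by
          rw [RingHom.mem_ker] at hx
          have hx0 : x = 0 := by
            have h := congrArg (fun y : integralClosure (𝓞 K') (AlgebraicClosure K) ↦ (y : AlgebraicClosure K)) hx
            simp only [Subalgebra.coe_algebraMap, ZeroMemClass.coe_zero] at h
            exact (FaithfulSMul.algebraMap_injective (𝓞 K') (AlgebraicClosure K)) (h.trans (map_zero _).symm)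
          rw [hx0]; exact zero_mem _)
    haveI := h𝔓'max
    haveI h𝔓'over : 𝔓'.LiesOver w.asIdeal := ⟨h𝔓'comap.symm⟩
    refine dvd_log_valuation_of_inertia_fixes_root two_pos hζ ha hα w 𝔓' fun τ hτ ↦ ?_
    let v : HeightOneSpectrum (𝓞 K) := HeightOneSpectrum.under (𝓞 K) w
    have hv : v ∉ S := hw
    let θ : absIntegers (𝓞 K) K →+* integralClosure (𝓞 K') (AlgebraicClosure K) :=
      Subring.inclusion (absIntegers_le_integralClosure' K')
    have hθ : ∀ x, (θ x : AlgebraicClosure K) = x := fun x ↦ rfl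
    let 𝔓 : Ideal (absIntegers (𝓞 K) K) := 𝔓'.comap θ
    haveI := h𝔓'max.isPrime
    have h𝔓 : 𝔓 ∈ v.primesAbove := by
      refine ⟨Ideal.comap_isPrime θ 𝔓', ⟨?_⟩⟩
      change (HeightOneSpectrum.under (𝓞 K) w).asIdeal =
        Ideal.comap (algebraMap (𝓞 K) (absIntegers (𝓞 K) K)) (Ideal.comap θ 𝔓')
      rw [HeightOneSpectrum.under_asIdeal, Ideal.comap_comap, h𝔓'over.over, Ideal.under,
        Ideal.under, Ideal.comap_comap]
      congr 1
    have hσI : ((e.symm τ : U') : absoluteGaloisGroup K) ∈ 𝔓.inertia (absoluteGaloisGroup K) := by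
      rw [Ideal.inertia, AddSubgroup.mem_inertia]
      intro x
      change θ (((e.symm τ : U') : absoluteGaloisGroup K) • x - x) ∈ 𝔓'
      have hθx : θ (((e.symm τ : U') : absoluteGaloisGroup K) • x) = τ • θ x := by
        apply Subtype.ext
        rw [hθ, integralClosure.coe_smul, integralClosure.coe_smul, hθ, he]
        rfl
      rw [map_sub, hθx]
      rw [Ideal.inertia, AddSubgroup.mem_inertia] at hτ
      exact hτ (θ x)
    have h0 : T τ = 0 := by
      rw [hT, hf.2.2 v hv 𝔓 h𝔓 (e.symm τ) hσI, map_zero]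
    rw [hσα τ, h0, ZMod.val_zero, pow_zero, one_mul]

/-- **Killing complex conjugations makes the Kummer generator totally positive.** In the situation of
`exists_kummerGenerator_two`, if `f` vanishes on every complex conjugation of `Gal(K̄/K)` lying in `U' = Gal(K̄/K')`
(`IsComplexConjugation φ c` for some real embedding `φ` of `K`), then `σ(a) > 0` for every real embedding `σ` of
`K'`: extend `σ` to `ι : K̄ → ℂ`, pull back complex conjugation to `c ∈ Gal(K̄/K')`
(`ComplexEmbedding.exists_comp_symm_eq_of_comp_eq`); `f(c) = 0` gives `c α = α`, so `ι α` is real and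
`σ(a) = ι(α)² > 0`. [cite: Washington1997, §13.3 (signature conditions in Kummer theory)] [folklore] -/
theorem embedding_pos_of_kills_complexConjugation (K' : IntermediateField K (AlgebraicClosure K))
    [FiniteDimensional K K'] (U' : Subgroup (absoluteGaloisGroup K))
    (e : U' ≃* (AlgebraicClosure K ≃ₐ[K'] AlgebraicClosure K))
    (he : ∀ (τ : AlgebraicClosure K ≃ₐ[K'] AlgebraicClosure K) (x : AlgebraicClosure K),
        ((e.symm τ : U') : absoluteGaloisGroup K) • x = τ x)
    (M : Type) [AddCommGroup M] (j : M →+ ZMod 2) {f : U' → M}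
    (hsign : ∀ u : U', (∃ φ : K →+* ℝ, IsComplexConjugation φ (u : absoluteGaloisGroup K)) → f u = 0)
    {a : K'} (ha : a ≠ 0) {α : AlgebraicClosure K} (hα : α ^ 2 = algebraMap K' (AlgebraicClosure K) a)
    (hτ : ∀ τ : AlgebraicClosure K ≃ₐ[K'] AlgebraicClosure K, τ α = (-1) ^ (j (f (e.symm τ))).val * α)
    (σ : K' →+* ℝ) : 0 < σ a := by
  classical
  haveI : Algebra.IsAlgebraic K (AlgebraicClosure K) := AlgebraicClosure.isAlgebraic K
  haveI : IsGalois K (AlgebraicClosure K) := {}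
  haveI : Algebra.IsAlgebraic K' (AlgebraicClosure K) := Algebra.IsAlgebraic.tower_top (K := K) K'
  haveI : IsGalois K' (AlgebraicClosure K) := IsGalois.tower_top_of_isGalois K K' (AlgebraicClosure K)
  -- an embedding `ι : K̄ → ℂ` extending `σ`
  letI : Algebra K' ℂ := (Complex.ofRealHom.comp σ).toAlgebra
  haveI : Module.IsTorsionFree K' ℂ := Module.IsTorsionFree.of_smul_eq_zero fun r m h ↦ by
    rw [Algebra.smul_def, mul_eq_zero] at h
    rcases h with h | h
    · left
      have h' : Complex.ofRealHom (σ r) = 0 := h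
      rw [map_eq_zero, map_eq_zero] at h'
      exact h'
    · exact Or.inr h
  let ι₀ : AlgebraicClosure K →ₐ[K'] ℂ := IsAlgClosed.lift
  let ι : AlgebraicClosure K →+* ℂ := ι₀
  have hι : ι.comp (algebraMap K' (AlgebraicClosure K)) = Complex.ofRealHom.comp σ := ι₀.comp_algebraMap
  have hι' : (ComplexEmbedding.conjugate ι).comp (algebraMap K' (AlgebraicClosure K)) = Complex.ofRealHom.comp σ := by
    ext1 x
    have hx := RingHom.congr_fun hι x
    rw [RingHom.comp_apply] at hx
    rw [RingHom.comp_apply, ComplexEmbedding.conjugate_coe_eq, hx, RingHom.comp_apply,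
      Complex.ofRealHom_eq_coe, Complex.conj_ofReal]
  -- pull back complex conjugation: `ι ∘ c = conj ∘ ι` with `c ∈ Gal(K̄/K')`
  obtain ⟨τ, hτc⟩ := ComplexEmbedding.exists_comp_symm_eq_of_comp_eq
    (k := K') (K := AlgebraicClosure K) _ _ (hι.trans hι'.symm)
  set c : AlgebraicClosure K ≃ₐ[K'] AlgebraicClosure K := τ.symm with hcdef
  have hconj : ∀ x, ι (c x) = starRingEnd ℂ (ι x) := fun x ↦ by
    have := RingHom.congr_fun hτc x
    simpa [ComplexEmbedding.conjugate_coe_eq] using this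
  -- `c`, as an element of `Γ_K`, is a complex conjugation for the real embedding `σ|_K`
  have hcc : ∃ φ : K →+* ℝ, IsComplexConjugation φ ((e.symm c : U') : absoluteGaloisGroup K) := by
    refine ⟨σ.comp (algebraMap K K'), ι, ComplexEmbedding.liesOver_iff.mpr ?_, ?_⟩
    · ext1 x
      have hx := RingHom.congr_fun hι (algebraMap K K' x)
      rw [RingHom.comp_apply, RingHom.comp_apply] at hx
      rw [RingHom.comp_apply, RingHom.comp_apply, RingHom.comp_apply,
        IsScalarTower.algebraMap_apply K K' (AlgebraicClosure K), hx]
    · change ComplexEmbedding.conjugate ι = ι.comp _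
      ext1 x
      rw [ComplexEmbedding.conjugate_coe_eq, RingHom.comp_apply, ← hconj]
      change ι (c x) = ι (((e.symm c : U') : absoluteGaloisGroup K) • x)
      rw [he]
  -- hence `f` kills it and `c` fixes `α`
  have hfix : c α = α := by
    have h0 : j (f (e.symm c)) = 0 := by rw [hsign (e.symm c) hcc, map_zero]
    rw [hτ c, h0, ZMod.val_zero, pow_zero, one_mul]
  -- `ι α` is real, `σ a = (ι α)²`
  have hreal : starRingEnd ℂ (ι α) = ι α := by rw [← hconj, hfix]
  have hσa : (σ a : ℂ) = ι α ^ 2 := by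
    have h1 := RingHom.congr_fun hι a
    rw [RingHom.comp_apply, RingHom.comp_apply, Complex.ofRealHom_eq_coe] at h1
    rw [← h1, ← map_pow, hα]
  obtain ⟨r, hr⟩ : ∃ r : ℝ, ι α = r := ⟨(ι α).re, (Complex.conj_eq_iff_re.mp hreal).symm⟩
  have hσa' : σ a = r ^ 2 := by
    have : (σ a : ℂ) = ((r ^ 2 : ℝ) : ℂ) := by rw [hσa, hr]; push_cast; ring
    exact_mod_cast this
  have hne : σ a ≠ 0 := by rw [Ne, map_eq_zero]; exact ha
  rw [hσa'] at hne ⊢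
  positivity

end Kummer

/-! ## §4 The count with the sign condition: `#T ≤ 2^{#S'}` -/

section Count

variable {K : Type} [Field K] [NumberField K]

/-- The additive valuation of a product. [folklore] -/
private theorem log_valuation_mul {L : Type*} [Field L] [NumberField L] (w : HeightOneSpectrum (𝓞 L))
    {a b : L} (ha : a ≠ 0) (hb : b ≠ 0) :
    WithZero.log (w.valuation L (a * b)) = WithZero.log (w.valuation L a) + WithZero.log (w.valuation L b) := by
  rw [map_mul, WithZero.log_mul ((Valuation.ne_zero_iff _).mpr ha) ((Valuation.ne_zero_iff _).mpr hb)]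

/-- Equal parities of `m` and `n` make `m + n` even. [folklore] -/
private theorem two_dvd_add_of_intCast_eq {m n : ℤ} (h : (m : ZMod 2) = (n : ZMod 2)) : (2 : ℤ) ∣ m + n := by
  have h2 : (2 : ℤ) ∣ n - m := (ZMod.intCast_eq_intCast_iff_dvd_sub m n 2).mp h
  have : m + n = (n - m) + 2 * m := by ring
  rw [this]
  exact dvd_add h2 (dvd_mul_right 2 m)

/-- **The Kummer parity count with the sign condition.** Let `K' ⊆ K̄` be finite over the number field `K`, with
`U' = Gal(K̄/K') ≤ Γ_K` open (given with an identification `e`), `h(K')` ODD and every totally positive unit of `K'` a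
square; let `M ↪ ℤ/2ℤ` and `S` a finite set of finite places of `K`. Then the continuous homomorphisms `f : U' → M`
that are unramified outside `S` (kill `U' ∩ I_𝔓` for every `𝔓 ∣ v ∉ S`) AND kill every complex conjugation of `Γ_K`
lying in `U'` form a finite set of size `≤ 2^{#S'}`, `S'` = the places of `K'` above `S`: the parity vector
`(ord_w(a_f) mod 2)_{w ∈ S'}` of the Kummer generator is injective, because two such `f` with equal parities have
`a_{f₁} a_{f₂}` totally positive with even valuations everywhere, hence a square
(`exists_eq_sq_of_even_valuation_of_totallyPositive`), and then `f₁ = f₂` (`kummer_generator_injective`).  At `K = ℚ`,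
`K' = ℚ_n` this is the count behind Greenberg's «`M_∞ = ℚ_∞` … `K_∞` can't contain any totally real subfield larger than
`ℚ_∞`» (LNM 1716, proof of Lemma 5.9 at `p = 2`, p. 113). [cite: GreenbergLNM1716, §5 Lemma 5.9 (proof, p = 2) and Prop. 5.14]
[cite: Washington1997, Thm. 10.4 / Cor. 10.5 and §13.3] -/
theorem finite_and_natCard_le_of_kills_complexConjugation (K' : IntermediateField K (AlgebraicClosure K))
    [FiniteDimensional K K'] (U' : Subgroup (absoluteGaloisGroup K))
    (e : U' ≃* (AlgebraicClosure K ≃ₐ[K'] AlgebraicClosure K))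
    (he : ∀ (τ : AlgebraicClosure K ≃ₐ[K'] AlgebraicClosure K) (x : AlgebraicClosure K),
        ((e.symm τ : U') : absoluteGaloisGroup K) • x = τ x)
    (hU'open : IsOpen (U' : Set (absoluteGaloisGroup K)))
    (M : Type) [AddCommGroup M] [TopologicalSpace M] [DiscreteTopology M] (j : M →+ ZMod 2)
    (hj : Function.Injective j)
    (hodd : haveI : NumberField K' := NumberField.of_module_finite K K'; Odd (classNumber K'))
    (hsq : ∀ u : (𝓞 K')ˣ, (∀ σ : K' →+* ℝ, 0 < σ ((u : 𝓞 K') : K')) → IsSquare u)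
    {S : Set (HeightOneSpectrum (𝓞 K))} (hS : S.Finite) :
    haveI : NumberField K' := NumberField.of_module_finite K K'
    Set.Finite {f : U' → M | f ∈ unramifiedHoms U' M S ∧
        ∀ u : U', (∃ φ : K →+* ℝ, IsComplexConjugation φ (u : absoluteGaloisGroup K)) → f u = 0} ∧
      Nat.card {f : U' → M | f ∈ unramifiedHoms U' M S ∧
        ∀ u : U', (∃ φ : K →+* ℝ, IsComplexConjugation φ (u : absoluteGaloisGroup K)) → f u = 0} ≤
        2 ^ Nat.card {w : HeightOneSpectrum (𝓞 K') | HeightOneSpectrum.under (𝓞 K) w ∈ S} := by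
  classical
  haveI : NumberField K' := NumberField.of_module_finite K K'
  have hζ : IsPrimitiveRoot (-1 : K') 2 := IsPrimitiveRoot.neg_one 0 (by decide)
  set T := {f : U' → M | f ∈ unramifiedHoms U' M S ∧
    ∀ u : U', (∃ φ : K →+* ℝ, IsComplexConjugation φ (u : absoluteGaloisGroup K)) → f u = 0} with hTdef
  set S' := {w : HeightOneSpectrum (𝓞 K') | HeightOneSpectrum.under (𝓞 K) w ∈ S} with hS'def
  haveI : Finite S' := (finite_setOf_under_mem K' hS).to_subtype
  -- Kummer data for each `f ∈ T`
  have hdata : ∀ f : T, ∃ a : K', a ≠ 0 ∧ ∃ α : AlgebraicClosure K, α ^ 2 = algebraMap K' (AlgebraicClosure K) a ∧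
      (∀ τ : AlgebraicClosure K ≃ₐ[K'] AlgebraicClosure K, τ α = (-1) ^ (j (f.1 (e.symm τ))).val * α) ∧
      ∀ w : HeightOneSpectrum (𝓞 K'), HeightOneSpectrum.under (𝓞 K) w ∉ S →
        (2 : ℤ) ∣ WithZero.log (w.valuation K' a) := fun f ↦
    exists_kummerGenerator_two K' U' e he hU'open M j f.2.1
  choose a ha α hα hτ hval using hdata
  have hpos : ∀ (f : T) (σ : K' →+* ℝ), 0 < σ (a f) := fun f σ ↦
    embedding_pos_of_kills_complexConjugation K' U' e he M j f.2.2 (ha f) (hα f) (hτ f) σ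
  -- the parity vector at `S'`
  let P : T → (S' → ZMod 2) := fun f w ↦ ((WithZero.log (w.1.valuation K' (a f)) : ℤ) : ZMod 2)
  have hP : Function.Injective P := by
    intro f₁ f₂ h12
    -- `a₁ a₂` is totally positive with even valuations everywhere, hence a square
    have hb0 : a f₁ * a f₂ ≠ 0 := mul_ne_zero (ha f₁) (ha f₂)
    have hbval : ∀ w : HeightOneSpectrum (𝓞 K'), (2 : ℤ) ∣ WithZero.log (w.valuation K' (a f₁ * a f₂)) := by
      intro w
      rw [log_valuation_mul w (ha f₁) (ha f₂)]
      by_cases hw : HeightOneSpectrum.under (𝓞 K) w ∈ S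
      · have h : ((WithZero.log (w.valuation K' (a f₁)) : ℤ) : ZMod 2) =
            ((WithZero.log (w.valuation K' (a f₂)) : ℤ) : ZMod 2) := congr_fun h12 ⟨w, hw⟩
        exact two_dvd_add_of_intCast_eq h
      · exact dvd_add (hval f₁ w hw) (hval f₂ w hw)
    have hbpos : ∀ σ : K' →+* ℝ, 0 < σ (a f₁ * a f₂) := fun σ ↦ by
      rw [map_mul]; exact mul_pos (hpos f₁ σ) (hpos f₂ σ)
    obtain ⟨γ, hγ⟩ := exists_eq_sq_of_even_valuation_of_totallyPositive K' hodd hsq hb0 hbpos hbval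
    -- `a₂ = a₁ (γ/a₁)²`, so the two characters coincide
    have hb : a f₂ = a f₁ * (γ / a f₁) ^ 2 := by
      have h1 : a f₁ ≠ 0 := ha f₁
      field_simp
      linear_combination hγ
    have hζ' : ∀ (f : T) (τ : AlgebraicClosure K ≃ₐ[K'] AlgebraicClosure K),
        τ (α f) = algebraMap K' (AlgebraicClosure K) (-1) ^ (j (f.1 (e.symm τ))).val * α f := fun f τ ↦ by
      rw [map_neg, map_one]; exact hτ f τ
    have hT12 := kummer_generator_injective (Ω := AlgebraicClosure K) two_pos hζ (ha f₁) (ha f₂) (hα f₁) (hα f₂)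
      (hζ' f₁) (hζ' f₂) hb
    apply Subtype.ext
    funext u
    apply hj
    have h := congr_fun hT12 (e u)
    simp only [MulEquiv.symm_apply_apply] at h
    exact h
  refine ⟨Set.finite_coe_iff.mp (Finite.of_injective P hP), ?_⟩
  calc Nat.card T ≤ Nat.card (S' → ZMod 2) := Nat.card_le_card_of_injective P hP
    _ = 2 ^ Nat.card S' := by rw [Nat.card_fun, Nat.card_zmod]

end Count

/-! ## §5 The count WITHOUT sign condition: unramified at ALL finite places outside an odd `S` -/

section CountCFT

variable {K : Type} [Field K] [NumberField K]

/-- A maximal ideal of `ℤ̄_K` lies above the finite place `𝔓 ∩ 𝓞 K` of `K` (copy of a tree helper). [folklore] -/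
private theorem exists_mem_primesAbove_of_isMaximal' (𝔓 : Ideal (absIntegers (𝓞 K) K))
    [h𝔓 : 𝔓.IsMaximal] : ∃ v : HeightOneSpectrum (𝓞 K), 𝔓 ∈ v.primesAbove := by
  haveI : (𝔓.under (𝓞 K)).IsMaximal := Ideal.IsMaximal.under (𝓞 K) 𝔓
  have hne : 𝔓.under (𝓞 K) ≠ ⊥ := Ring.ne_bot_of_isMaximal_of_not_isField inferInstance
    (RingOfIntegers.not_isField K)
  exact ⟨⟨𝔓.under (𝓞 K), Ideal.IsMaximal.isPrime inferInstance, hne⟩,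
    HeightOneSpectrum.mem_primesAbove_iff.mpr ⟨h𝔓.isPrime, ⟨rfl⟩⟩⟩

omit [NumberField K] in
/-- `ℤ̄_K` and the integral closure of `𝓞 K'` in `K̄` have the same carrier (integrality is transitive). [folklore] -/
private theorem absIntegers_toSubring_eq (K' : IntermediateField K (AlgebraicClosure K)) [FiniteDimensional K K'] :
    (absIntegers (𝓞 K) K).toSubring = (integralClosure (𝓞 K') (AlgebraicClosure K)).toSubring := by
  refine le_antisymm (absIntegers_le_integralClosure K') fun x hx ↦ ?_
  change IsIntegral (𝓞 K') x at hx
  change IsIntegral (𝓞 K) x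
  exact (isIntegral_trans (R := ℤ) x hx).tower_top

set_option maxHeartbeats 1600000 in
/-- **The Kummer parity count for characters unramified at ALL finite places outside an ODD set `S`.** Let
`U' ≤ Γ_K` be open and NORMAL with fixed field `F = K̄^{U'}` totally real of ODD class number in which every totally
positive unit is a square, `M ↪ ℤ/2ℤ`, and `S` a finite set of finite places of `K` none of which lies above `2`.
Then `Hom(U', M; S)` (continuous homomorphisms killing `U' ∩ I_𝔓` for EVERY `𝔓 ∣ v ∉ S`, in particular at all
places above `2`; no condition at the real places) is finite of size `≤ 2^{#S'}`, `S'` = the places of `F` above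
`S`: the parity vector `(ord_w(a_f) mod 2)_{w ∈ S'}` is injective — two characters with the same parities differ by a
character `g` whose Kummer class is `[u]` for a UNIT `u` (`exists_unit_mul_sq_of_even_valuation`), so `g` is also
unramified at the (odd) places of `S'` (`inertia_fixes_root_of_not_mem`), hence at every finite place, hence `g = 0`
by the narrow class-field-theoretic vanishing `eq_zero_of_kills_inertia_of_odd_classNumber_of_forall_isSquare`
(«`L*_∞ = ℚ_∞`», Greenberg LNM 1716 p. 122). [cite: GreenbergLNM1716, §5, proof of Prop. 5.14 (p. 122)]
[cite: Washington1997, Thm. 10.4 / Cor. 10.5 and §13.3] [cite: Lang1983, Ch. 6 Prop. 1.3] -/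
theorem finite_and_natCard_le_unramifiedHoms_of_odd (U' : Subgroup (absoluteGaloisGroup K)) [U'.Normal]
    (hU'open : IsOpen (U' : Set (absoluteGaloisGroup K)))
    [IsTotallyReal ↥(fixedField U' : IntermediateField K (AlgebraicClosure K))]
    (hodd : haveI : FiniteDimensional K ↥(fixedField U' : IntermediateField K (AlgebraicClosure K)) :=
        finiteDimensional_fixedField_of_isOpen U' hU'open
      haveI : NumberField ↥(fixedField U' : IntermediateField K (AlgebraicClosure K)) := NumberField.of_module_finite K _
      Odd (classNumber ↥(fixedField U' : IntermediateField K (AlgebraicClosure K))))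
    (hsq : ∀ u : (𝓞 ↥(fixedField U' : IntermediateField K (AlgebraicClosure K)))ˣ,
      (∀ σ : ↥(fixedField U' : IntermediateField K (AlgebraicClosure K)) →+* ℝ,
        0 < σ ((u : 𝓞 ↥(fixedField U' : IntermediateField K (AlgebraicClosure K))) : ↥(fixedField U'))) →
        IsSquare u)
    (M : Type) [AddCommGroup M] [TopologicalSpace M] [DiscreteTopology M] (j : M →+ ZMod 2)
    (hj : Function.Injective j)
    {S : Set (HeightOneSpectrum (𝓞 K))} (hS : S.Finite) (hSodd : ∀ v ∈ S, ((2 : ℕ) : 𝓞 K) ∉ v.asIdeal) :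
    haveI : FiniteDimensional K ↥(fixedField U' : IntermediateField K (AlgebraicClosure K)) :=
      finiteDimensional_fixedField_of_isOpen U' hU'open
    haveI : NumberField ↥(fixedField U' : IntermediateField K (AlgebraicClosure K)) := NumberField.of_module_finite K _
    Set.Finite (unramifiedHoms U' M S) ∧
      Nat.card (unramifiedHoms U' M S) ≤
        2 ^ Nat.card {w : HeightOneSpectrum (𝓞 ↥(fixedField U' : IntermediateField K (AlgebraicClosure K))) |
          HeightOneSpectrum.under (𝓞 K) w ∈ S} := by
  classical
  set K' : IntermediateField K (AlgebraicClosure K) := fixedField U' with hK'def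
  haveI : FiniteDimensional K K' := finiteDimensional_fixedField_of_isOpen U' hU'open
  haveI : NumberField K' := NumberField.of_module_finite K K'
  have hU' : U' = K'.fixingSubgroup := (fixingSubgroup_fixedField_of_isOpen U' hU'open).symm
  obtain ⟨e, he⟩ := exists_mulEquiv_fixingSubgroup K' U' hU'
  have hζ : IsPrimitiveRoot (-1 : K') 2 := IsPrimitiveRoot.neg_one 0 (by decide)
  -- `M` is killed by `2`
  have h2M : ∀ m : M, 2 ^ 1 • m = 0 := fun m ↦ hj (by
    rw [map_nsmul, map_zero, pow_one]
    exact (ZMod.natCast_self 2 ▸ nsmul_eq_mul 2 (j m) ▸ (zero_mul (j m))))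
  set T := unramifiedHoms U' M S with hTdef
  set S' := {w : HeightOneSpectrum (𝓞 K') | HeightOneSpectrum.under (𝓞 K) w ∈ S} with hS'def
  haveI : Finite S' := (finite_setOf_under_mem K' hS).to_subtype
  -- Kummer data for each `f ∈ T`
  have hdata : ∀ f : T, ∃ a : K', a ≠ 0 ∧ ∃ α : AlgebraicClosure K, α ^ 2 = algebraMap K' (AlgebraicClosure K) a ∧
      (∀ τ : AlgebraicClosure K ≃ₐ[K'] AlgebraicClosure K, τ α = (-1) ^ (j (f.1 (e.symm τ))).val * α) ∧
      ∀ w : HeightOneSpectrum (𝓞 K'), HeightOneSpectrum.under (𝓞 K) w ∉ S →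
        (2 : ℤ) ∣ WithZero.log (w.valuation K' a) := fun f ↦
    exists_kummerGenerator_two K' U' e he hU'open M j f.2
  choose a ha α hα hτ hval using hdata
  -- the parity vector at `S'`
  let P : T → (S' → ZMod 2) := fun f w ↦ ((WithZero.log (w.1.valuation K' (a f)) : ℤ) : ZMod 2)
  have hP : Function.Injective P := by
    intro f₁ f₂ h12
    -- `a₁ a₂` has even valuations everywhere, hence is a unit times a square
    have hb0 : a f₁ * a f₂ ≠ 0 := mul_ne_zero (ha f₁) (ha f₂)
    have hbval : ∀ w : HeightOneSpectrum (𝓞 K'), (2 : ℤ) ∣ WithZero.log (w.valuation K' (a f₁ * a f₂)) := by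
      intro w
      rw [log_valuation_mul w (ha f₁) (ha f₂)]
      by_cases hw : HeightOneSpectrum.under (𝓞 K) w ∈ S
      · have h : ((WithZero.log (w.valuation K' (a f₁)) : ℤ) : ZMod 2) =
            ((WithZero.log (w.valuation K' (a f₂)) : ℤ) : ZMod 2) := congr_fun h12 ⟨w, hw⟩
        exact two_dvd_add_of_intCast_eq h
      · exact dvd_add (hval f₁ w hw) (hval f₂ w hw)
    obtain ⟨u, c, hc, hbuc⟩ := exists_unit_mul_sq_of_even_valuation K' hodd hb0 hbval
    -- the difference character `g = f₁ - f₂` and its Kummer datum `(u, α₁ α₂ / c)`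
    let g : U' → M := fun x ↦ f₁.1 x - f₂.1 x
    have hgadd : ∀ x y : U', g (x * y) = g x + g y := fun x y ↦ by
      change f₁.1 (x * y) - f₂.1 (x * y) = (f₁.1 x - f₂.1 x) + (f₁.1 y - f₂.1 y)
      rw [f₁.2.2.1, f₂.2.2.1]; abel
    set β : AlgebraicClosure K := α f₁ * α f₂ / algebraMap K' (AlgebraicClosure K) c with hβdef
    have hcA : algebraMap K' (AlgebraicClosure K) c ≠ 0 := by
      rw [Ne, map_eq_zero_iff _ (algebraMap K' (AlgebraicClosure K)).injective]; exact hc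
    have hβsq : β ^ 2 = algebraMap (𝓞 K') (AlgebraicClosure K) (u : 𝓞 K') := by
      change β ^ 2 = algebraMap K' (AlgebraicClosure K) ((u : 𝓞 K') : K')
      rw [hβdef, div_pow, mul_pow, hα, hα, ← map_mul, hbuc, ← map_pow, ← map_div₀]
      congr 1
      field_simp
    have hβτ : ∀ τ : AlgebraicClosure K ≃ₐ[K'] AlgebraicClosure K,
        τ β = (-1) ^ ((j (f₁.1 (e.symm τ))).val + (j (f₂.1 (e.symm τ))).val) * β := fun τ ↦ by
      rw [hβdef, map_div₀, map_mul, hτ f₁ τ, hτ f₂ τ, AlgEquiv.commutes, pow_add]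
      ring
    have hβ0 : β ≠ 0 := by
      rw [hβdef]
      refine div_ne_zero (mul_ne_zero ?_ ?_) hcA
      · intro h0; apply ha f₁
        have := hα f₁; rw [h0, zero_pow two_ne_zero, eq_comm, map_eq_zero_iff _ (algebraMap K' _).injective] at this
        exact this
      · intro h0; apply ha f₂
        have := hα f₂; rw [h0, zero_pow two_ne_zero, eq_comm, map_eq_zero_iff _ (algebraMap K' _).injective] at this
        exact this
    -- `g` kills EVERY inertia group
    have hgI : ∀ (𝔓 : Ideal (absIntegers (𝓞 K) K)), 𝔓.IsMaximal →
        ∀ x : U', (x : absoluteGaloisGroup K) ∈ 𝔓.inertia (absoluteGaloisGroup K) → g x = 0 := by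
      intro 𝔓 h𝔓max x hx
      haveI := h𝔓max
      obtain ⟨v, hv⟩ := exists_mem_primesAbove_of_isMaximal' 𝔓
      by_cases hvS : v ∈ S
      · -- at an odd place of `S`: the Kummer class of `g` is the unit `u`, so `g` is unramified there
        -- transport `𝔓` to a prime `𝔓'` of the integral closure of `𝓞 K'`
        let θ : absIntegers (𝓞 K) K ≃+* integralClosure (𝓞 K') (AlgebraicClosure K) :=
          RingEquiv.subringCongr (absIntegers_toSubring_eq K')
        have hθ : ∀ y, (θ y : AlgebraicClosure K) = y := fun y ↦ rfl
        let 𝔓' : Ideal (integralClosure (𝓞 K') (AlgebraicClosure K)) := 𝔓.comap (θ.symm : _ →+* _)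
        haveI h𝔓'max : 𝔓'.IsMaximal := Ideal.comap_isMaximal_of_equiv θ.symm
        haveI := h𝔓'max.isPrime
        have hmem𝔓' : ∀ z : absIntegers (𝓞 K) K, θ z ∈ 𝔓' ↔ z ∈ 𝔓 := fun z ↦ by
          change (θ.symm : _ →+* _) (θ z) ∈ 𝔓 ↔ z ∈ 𝔓
          rw [RingEquiv.coe_toRingHom, RingEquiv.symm_apply_apply]
        -- the place `w` of `K'` under `𝔓'`, above `v`
        have hwne : 𝔓'.under (𝓞 K') ≠ ⊥ := by
          haveI : (𝔓'.under (𝓞 K')).IsMaximal := Ideal.IsMaximal.under (𝓞 K') 𝔓'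
          exact Ring.ne_bot_of_isMaximal_of_not_isField inferInstance (RingOfIntegers.not_isField K')
        let w : HeightOneSpectrum (𝓞 K') := ⟨𝔓'.under (𝓞 K'), Ideal.IsPrime.under (𝓞 K') 𝔓', hwne⟩
        haveI h𝔓'w : 𝔓'.LiesOver w.asIdeal := ⟨rfl⟩
        have hkey : ∀ x : 𝓞 K, algebraMap (𝓞 K') (integralClosure (𝓞 K') (AlgebraicClosure K))
            (algebraMap (𝓞 K) (𝓞 K') x) = θ (algebraMap (𝓞 K) (absIntegers (𝓞 K) K) x) := fun x ↦ by
          apply Subtype.ext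
          rw [hθ]
          change algebraMap K' (AlgebraicClosure K) (algebraMap K K' (x : K)) = algebraMap K (AlgebraicClosure K) (x : K)
          rw [← IsScalarTower.algebraMap_apply]
        have hwv : HeightOneSpectrum.under (𝓞 K) w = v := by
          apply HeightOneSpectrum.ext
          rw [HeightOneSpectrum.under_asIdeal, hv.2.over]
          ext x
          rw [Ideal.under, Ideal.mem_comap, Ideal.under, Ideal.mem_comap]
          rw [hkey, hmem𝔓']
          exact Ideal.mem_comap.symm
        have hw2 : ((2 : ℕ) : 𝓞 K') ∉ w.asIdeal := by
          intro h2
          apply hSodd v hvS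
          rw [← hwv, HeightOneSpectrum.under_asIdeal]
          change algebraMap (𝓞 K) (𝓞 K') ((2 : ℕ) : 𝓞 K) ∈ w.asIdeal
          rw [map_natCast]
          exact h2
        have huw : (u : 𝓞 K') ∉ w.asIdeal := fun h ↦
          w.isPrime.ne_top (Ideal.eq_top_of_isUnit_mem _ h u.isUnit)
        -- `e x ∈ I_{𝔓'}`, so it fixes `β`
        have hxI : e x ∈ 𝔓'.inertia (AlgebraicClosure K ≃ₐ[K'] AlgebraicClosure K) := by
          rw [Ideal.inertia, AddSubgroup.mem_inertia]
          intro y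
          have hy : (e x) • y - y = θ ((x : absoluteGaloisGroup K) • θ.symm y - θ.symm y) := by
            apply Subtype.ext
            rw [map_sub]
            change ((e x) • y : integralClosure (𝓞 K') (AlgebraicClosure K)).1 - y.1 = _
            rw [integralClosure.coe_smul, AddSubgroupClass.coe_sub, hθ, hθ, integralClosure.coe_smul]
            have h1 : ((x : absoluteGaloisGroup K) • ((θ.symm y : absIntegers (𝓞 K) K) : AlgebraicClosure K)) =
                (e x) ((θ.symm y : absIntegers (𝓞 K) K) : AlgebraicClosure K) := by
              have := he (e x) ((θ.symm y : absIntegers (𝓞 K) K) : AlgebraicClosure K)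
              rw [MulEquiv.symm_apply_apply] at this
              exact this
            rw [h1]
            rfl
          rw [hy, Submodule.mem_toAddSubgroup, hmem𝔓']
          rw [Ideal.inertia, AddSubgroup.mem_inertia] at hx
          exact hx (θ.symm y)
        have hfix : (e x) β = β := inertia_fixes_root_of_not_mem (k := K') (Ω := AlgebraicClosure K) w huw hw2 hβsq 𝔓' hxI
        -- compare with the Kummer action: the signs of `f₁` and `f₂` at `x` agree
        have hsign : (-1 : AlgebraicClosure K) ^ ((j (f₁.1 x)).val + (j (f₂.1 x)).val) = 1 := by
          have h := hβτ (e x)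
          rw [hfix, MulEquiv.symm_apply_apply] at h
          have h' : ((-1 : AlgebraicClosure K) ^ ((j (f₁.1 x)).val + (j (f₂.1 x)).val) - 1) * β = 0 := by
            rw [sub_mul, one_mul, ← h, sub_self]
          rcases mul_eq_zero.mp h' with h'' | h''
          · exact sub_eq_zero.mp h''
          · exact absurd h'' hβ0
        have heven : Even ((j (f₁.1 x)).val + (j (f₂.1 x)).val) := by
          by_contra hodd'
          rw [Nat.not_even_iff_odd] at hodd'
          rw [hodd'.neg_one_pow] at hsign
          have h2 : (2 : AlgebraicClosure K) = 0 := by linear_combination -hsign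
          exact two_ne_zero h2
        apply hj
        change j (f₁.1 x - f₂.1 x) = j 0
        rw [map_sub, map_zero, sub_eq_zero]
        have h1 := ZMod.natCast_zmod_val (j (f₁.1 x))
        have h2 := ZMod.natCast_zmod_val (j (f₂.1 x))
        rw [← h1, ← h2, ZMod.natCast_eq_natCast_iff']
        obtain ⟨m, hm⟩ := heven
        have hlt1 := ZMod.val_lt (j (f₁.1 x))
        have hlt2 := ZMod.val_lt (j (f₂.1 x))
        omega
      · -- outside `S` both `f₁` and `f₂` are unramified
        change f₁.1 x - f₂.1 x = 0
        rw [f₁.2.2.2 v hvS 𝔓 hv x hx, f₂.2.2.2 v hvS 𝔓 hv x hx, sub_zero]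
    -- an open normal subgroup `W ≤ U'` killed by `g` (continuity)
    haveI : TotallyDisconnectedSpace (absoluteGaloisGroup K) := inferInstance
    have hgcont : Continuous g := f₁.2.1.sub f₂.2.1
    have hV : IsOpen ((Subtype.val : U' → absoluteGaloisGroup K) '' (g ⁻¹' {0})) :=
      hU'open.isOpenMap_subtype_val _ ((isOpen_discrete _).preimage hgcont)
    have h1V : (1 : absoluteGaloisGroup K) ∈ (Subtype.val : U' → absoluteGaloisGroup K) '' (g ⁻¹' {0}) := by
      refine ⟨1, ?_, rfl⟩
      change g 1 = 0
      have := hgadd 1 1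
      rw [mul_one] at this
      exact left_eq_add.mp this
    obtain ⟨W, hW⟩ := ProfiniteGrp.exist_openNormalSubgroup_sub_open_nhds_of_one hV h1V
    have hWU : (W : Subgroup (absoluteGaloisGroup K)) ≤ U' := by
      intro w hw
      obtain ⟨x, -, hx⟩ := hW hw
      rw [← hx]; exact x.2
    have hW0 : ∀ x : U', (x : absoluteGaloisGroup K) ∈ (W : Subgroup (absoluteGaloisGroup K)) → g x = 0 := by
      intro x hx
      obtain ⟨y, hy, hyx⟩ := hW hx
      have : y = x := Subtype.ext hyx
      rw [← this]; exact hy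
    -- the narrow class-field-theoretic vanishing
    have hg0 := UnramifiedHomsOddNarrowClassNumber.eq_zero_of_kills_inertia_of_odd_classNumber_of_forall_isSquare
      U' (W : Subgroup (absoluteGaloisGroup K)) 1 hU'open W.isOpen' hWU hodd hsq M h2M g hgadd hW0 hgI
    apply Subtype.ext
    funext x
    exact sub_eq_zero.mp (hg0 x)
  refine ⟨Set.finite_coe_iff.mp (Finite.of_injective P hP), ?_⟩
  calc Nat.card T ≤ Nat.card (S' → ZMod 2) := Nat.card_le_card_of_injective P hP
    _ = 2 ^ Nat.card S' := by rw [Nat.card_fun, Nat.card_zmod]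

end CountCFT

end Literature.NumberTheory.NumberFields.QuadraticCharactersOddClassNumberCount

end
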